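import Summits.AnomalousDissipation.AnomalousDissipation.Theorems.SawtoothPulseCascadeK1LocalisedCascadeKHModeSource
import Summits.AnomalousDissipation.AnomalousDissipation.Theorems.SawtoothPulseCascadeK1LocalisedCascadeKHLineKernelSum

/-!
# K2 lane (route-2 `SawtoothPulseCascade`, crux dir `K1LocalisedCascade`): the single-mode source at a LATTICE mode `ξ = β + n` — PAIRED boundary terms

Helper file of the K2 lane (ACL item stmt-AnomalousDissipation-19491; E6 / energy-form creation law, arbiter A27-7/A27-9). The two-envelope bound of
`…KHModeSource` treats the six closed-form terms of the source `src(±¼, s) = ∫ G(±¼−y) e^{2πiξy} e^{−2πiasT(y)} dy` (`…KHSourceResponse`,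
`src_quarter_pieces`) one by one, which gives the `1/√(1+(ξ/a∓s)²)` Doppler envelopes — a `1/|ξ|` law for far modes. Here the twelve half-terms are
REGROUPED BY BOUNDARY POINT (`six_pieces_regroup`): at the kernel's own line the two one-sided terms are tied by the continuity of the integrand
(`norm_kink_pair_le`), at the other kink line they agree termwise (`norm_same_pair_eq`), and at `y = ±½` they cancel exactly when `ξ − β ∈ ℤ`
(Bloch periodicity). The result is the PAIRED pointwise bound
`‖src(¼,s)‖ ≤ (1/(1+(u−s)²) + q/(1+(u+s)²) + (1+q+2x²)|s|/(√(1+(u+s)²)√(1+(u−s)²)))/((1−q)κ²)`, `u = ξ/a`, `κ = 2πa`, `q = e^{−κ}`, `x = e^{−κ/4}`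
(`norm_src_quarter_lattice_le`; mirror statement for `y₀ = −¼`), i.e. a `1/ξ²` law for far modes — the input of the energy-form (`ℓ²`) creation law.
No definitions; no statement about the crux. [cite: Drazin2002, §8.3 (8.36)–(8.38)] [problem: turb]
-/

-- `Summit.<Summit>.<Problem>`: single-conjunct summit, the duplicate namespace segment is deliberate.
set_option linter.dupNamespace false

noncomputable section

namespace Summit.AnomalousDissipation.AnomalousDissipation.Theorems.SawtoothPulseCascade.K2PhaseBudget

open Set MeasureTheory intervalIntegral Literature.Analysis.FluidPDE.SawtoothCascade

/-! ## §1 Algebra of boundary pairs -/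

/-- Regrouping the three two-term pieces (twelve half-terms) by boundary point: `y = ¼`, `y = −¼`, `y = ±½`. [folklore] -/
theorem six_pieces_regroup (P₁ P₂ P₃ a₁ b₁ a₂ b₂ a₃ b₃ L₁ L₂ L₃ L₄ e1m4 e1m2 e2m4 e2m2 e3p4 e3m4 e4p4 e4m4 e1p2 e1p4 e2p2 e2p4 : ℂ) :
    P₁ * (a₁ * ((e1m4 - e1m2) / L₁) + b₁ * ((e2m4 - e2m2) / L₂)) +
        P₂ * (a₂ * ((e3p4 - e3m4) / L₃) + b₂ * ((e4p4 - e4m4) / L₄)) +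
        P₃ * (a₃ * ((e1p2 - e1p4) / L₁) + b₃ * ((e2p2 - e2p4) / L₂)) =
      (P₂ * a₂ * e3p4 / L₃ + P₂ * b₂ * e4p4 / L₄ - P₃ * a₃ * e1p4 / L₁ - P₃ * b₃ * e2p4 / L₂) +
        ((P₁ * a₁ * e1m4 / L₁ - P₂ * a₂ * e3m4 / L₃) + (P₁ * b₁ * e2m4 / L₂ - P₂ * b₂ * e4m4 / L₄)) +
        ((P₃ * a₃ * e1p2 / L₁ - P₁ * a₁ * e1m2 / L₁) + (P₃ * b₃ * e2p2 / L₂ - P₁ * b₁ * e2m2 / L₂)) := by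
  ring

/-- **Kink pair.** One-sided boundary terms `L₊/d₃ + L₋/d₄` (left) and `R₊/d₁ + R₋/d₂` (right) of an integrand CONTINUOUS at the point
(`L₊ + L₋ = R₊ + R₋`) differ by paired quantities only. [folklore] -/
theorem norm_kink_pair_le {Lp Lm Rp Rm d₁ d₂ d₃ d₄ : ℂ} (hV : Lp + Lm = Rp + Rm) (h₁ : d₁ ≠ 0) (h₂ : d₂ ≠ 0)
    (h₃ : d₃ ≠ 0) (h₄ : d₄ ≠ 0) :
    ‖Lp / d₃ + Lm / d₄ - Rp / d₁ - Rm / d₂‖ ≤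
      ‖Lp‖ * ‖d₄ - d₃‖ / (‖d₃‖ * ‖d₄‖) + ‖Rp‖ * ‖d₂ - d₁‖ / (‖d₁‖ * ‖d₂‖) + ‖Lp + Lm‖ * ‖d₂ - d₄‖ / (‖d₂‖ * ‖d₄‖) := by
  have hRm : Rm = Lp + Lm - Rp := by rw [hV]; ring
  have e : Lp / d₃ + Lm / d₄ - Rp / d₁ - Rm / d₂ =
      Lp * ((d₄ - d₃) / (d₃ * d₄)) - Rp * ((d₂ - d₁) / (d₁ * d₂)) + (Lp + Lm) * ((d₂ - d₄) / (d₂ * d₄)) := by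
    rw [hRm]; field_simp; ring
  rw [e]
  refine (norm_add_le _ _).trans (add_le_add ((norm_sub_le _ _).trans (le_of_eq ?_)) (le_of_eq ?_))
  · rw [norm_mul, norm_mul, norm_div, norm_div, norm_mul, norm_mul]; ring
  · rw [norm_mul, norm_div, norm_mul]; ring

/-- **Termwise pair.** `‖τ/d − τ/d′‖ = ‖τ‖‖d′ − d‖/(‖d‖‖d′‖)`. [folklore] -/
theorem norm_same_pair_eq (τ : ℂ) {d d' : ℂ} (hd : d ≠ 0) (hd' : d' ≠ 0) :
    ‖τ / d - τ / d'‖ = ‖τ‖ * ‖d' - d‖ / (‖d‖ * ‖d'‖) := by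
  have : τ / d - τ / d' = τ * ((d' - d) / (d * d')) := by field_simp
  rw [this, norm_mul, norm_div, norm_mul]
  ring

/-! ## §2 Atoms: the Bloch factor, the kernel coefficients, the phases -/

/-- **The continuity of the kernel at its own line, as an identity of the coefficients:** `A + B = z̄(A·q + B·e^{κ})`
(`A = −1/((1−z̄q)2κ)`, `B = −zq/((1−zq)2κ)`, `q = e^{−κ}`, `κ = 2πa > 0`). [folklore] -/
theorem kernel_coef_continuity {a : ℝ} (ha : 0 < a) (β : ℝ) :
    (-1 / ((1 - starRingEnd ℂ (Complex.exp (2 * Real.pi * β * Complex.I)) * (Real.exp (-(2 * Real.pi * a)) : ℂ)) * (2 * (2 * Real.pi * a))) : ℂ) +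
      (-(Complex.exp (2 * Real.pi * β * Complex.I) * (Real.exp (-(2 * Real.pi * a)) : ℂ)) /
        ((1 - Complex.exp (2 * Real.pi * β * Complex.I) * (Real.exp (-(2 * Real.pi * a)) : ℂ)) * (2 * (2 * Real.pi * a))) : ℂ) =
    starRingEnd ℂ (Complex.exp (2 * Real.pi * β * Complex.I)) *
      ((-1 / ((1 - starRingEnd ℂ (Complex.exp (2 * Real.pi * β * Complex.I)) * (Real.exp (-(2 * Real.pi * a)) : ℂ)) * (2 * (2 * Real.pi * a))) : ℂ) *
          (Real.exp (-(2 * Real.pi * a)) : ℂ) +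
        (-(Complex.exp (2 * Real.pi * β * Complex.I) * (Real.exp (-(2 * Real.pi * a)) : ℂ)) /
          ((1 - Complex.exp (2 * Real.pi * β * Complex.I) * (Real.exp (-(2 * Real.pi * a)) : ℂ)) * (2 * (2 * Real.pi * a))) : ℂ) *
          (Real.exp (2 * Real.pi * a) : ℂ)) := by
  set z : ℂ := Complex.exp (2 * Real.pi * β * Complex.I) with hz
  set q : ℝ := Real.exp (-(2 * Real.pi * a)) with hq
  have hzn : ‖z‖ = 1 := by
    rw [hz, show (2 * Real.pi * β * Complex.I : ℂ) = ((2 * Real.pi * β : ℝ) : ℂ) * Complex.I by push_cast; ring]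
    exact Complex.norm_exp_ofReal_mul_I _
  have hzz : z * starRingEnd ℂ z = 1 := by
    rw [Complex.mul_conj, Complex.normSq_eq_norm_sq, hzn]; simp
  have hz0 : z ≠ 0 := Complex.exp_ne_zero _
  have hzc : starRingEnd ℂ z = z⁻¹ := (eq_inv_of_mul_eq_one_right hzz)
  have hq0' : 0 < q := Real.exp_pos _
  have hq1 : q < 1 := by rw [hq]; exact Real.exp_lt_one_iff.2 (by nlinarith [Real.pi_pos])
  have hqQ : (q : ℂ) * (Real.exp (2 * Real.pi * a) : ℂ) = 1 := by
    rw [← Complex.ofReal_mul, hq, ← Real.exp_add, neg_add_cancel, Real.exp_zero, Complex.ofReal_one]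
  have hq0 : (q : ℂ) ≠ 0 := Complex.ofReal_ne_zero.2 hq0'.ne'
  have hQ : (Real.exp (2 * Real.pi * a) : ℂ) = (q : ℂ)⁻¹ := (eq_inv_of_mul_eq_one_right hqQ)
  have hzq : z - (q : ℂ) ≠ 0 := by
    intro h
    have : ‖z‖ = ‖(q : ℂ)‖ := by rw [sub_eq_zero.1 h]
    rw [hzn, Complex.norm_real, Real.norm_eq_abs, abs_of_pos hq0'] at this
    linarith
  have hd1 : (1 : ℂ) - z * (q : ℂ) ≠ 0 := one_sub_mul_ne_zero hzn hq0'.le hq1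
  have ha0 : (a : ℂ) ≠ 0 := Complex.ofReal_ne_zero.2 ha.ne'
  have hπ0 : (Real.pi : ℂ) ≠ 0 := Complex.ofReal_ne_zero.2 Real.pi_pos.ne'
  rw [hQ, hzc]
  field_simp
  ring


/-! ## §3 Exponential identities of the twelve half-terms at `ξ = β + n` -/

section expid

variable (a ξ s : ℝ)

/-- `e^{iπas}·e^{(κ+iΛ₊)(−¼)} = e^{(κ+iΛ₋)(−¼)}` (the trough/centre `A`-terms agree at `y = −¼`). [folklore] -/
theorem expid_m14_A :
    Complex.exp ((((Real.pi * a) * s : ℝ)) * Complex.I) * Complex.exp (((((((2 * Real.pi * a)) : ℝ)) : ℂ) + ((((2 * Real.pi * ξ) + (2 * Real.pi * a) * s : ℝ)) : ℂ) * Complex.I) * (((-(1 / 4 : ℝ)) : ℝ) : ℂ)) =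
      Complex.exp ((((0 : ℝ) * s : ℝ)) * Complex.I) * Complex.exp (((((((2 * Real.pi * a)) : ℝ)) : ℂ) + ((((2 * Real.pi * ξ) + (-(2 * Real.pi * a)) * s : ℝ)) : ℂ) * Complex.I) * (((-(1 / 4 : ℝ)) : ℝ) : ℂ)) := by
  rw [← Complex.exp_add, ← Complex.exp_add]
  congr 1
  push_cast
  ring

/-- The trough/centre `B`-terms agree at `y = −¼`. [folklore] -/
theorem expid_m14_B :
    Complex.exp ((((Real.pi * a) * s : ℝ)) * Complex.I) * Complex.exp ((((((-(2 * Real.pi * a)) : ℝ)) : ℂ) + ((((2 * Real.pi * ξ) + (2 * Real.pi * a) * s : ℝ)) : ℂ) * Complex.I) * (((-(1 / 4 : ℝ)) : ℝ) : ℂ)) =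
      Complex.exp ((((0 : ℝ) * s : ℝ)) * Complex.I) * Complex.exp ((((((-(2 * Real.pi * a)) : ℝ)) : ℂ) + ((((2 * Real.pi * ξ) + (-(2 * Real.pi * a)) * s : ℝ)) : ℂ) * Complex.I) * (((-(1 / 4 : ℝ)) : ℝ) : ℂ)) := by
  rw [← Complex.exp_add, ← Complex.exp_add]
  congr 1
  push_cast
  ring

/-- `e^{−κ/4}·e^{(κ+iΛ₋)/4} = e^{iΛ₋/4}`. [folklore] -/
theorem expid_14_W1 :
    Complex.exp (-(((2 * Real.pi * a) : ℝ) : ℂ) * (1 / 4 : ℝ)) * Complex.exp (((((((2 * Real.pi * a)) : ℝ)) : ℂ) + ((((2 * Real.pi * ξ) + (-(2 * Real.pi * a)) * s : ℝ)) : ℂ) * Complex.I) * ((((1 / 4 : ℝ)) : ℝ) : ℂ)) = Complex.exp (((((2 * Real.pi * ξ) + (-(2 * Real.pi * a)) * s) * (1 / 4) : ℝ) : ℂ) * Complex.I) := by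
  rw [← Complex.exp_add]
  congr 1
  push_cast
  ring

/-- `e^{κ/4}·e^{(−κ+iΛ₋)/4} = e^{iΛ₋/4}`. [folklore] -/
theorem expid_14_W2 :
    Complex.exp ((((2 * Real.pi * a) : ℝ) : ℂ) * (1 / 4 : ℝ)) * Complex.exp ((((((-(2 * Real.pi * a)) : ℝ)) : ℂ) + ((((2 * Real.pi * ξ) + (-(2 * Real.pi * a)) * s : ℝ)) : ℂ) * Complex.I) * ((((1 / 4 : ℝ)) : ℝ) : ℂ)) = Complex.exp (((((2 * Real.pi * ξ) + (-(2 * Real.pi * a)) * s) * (1 / 4) : ℝ) : ℂ) * Complex.I) := by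
  rw [← Complex.exp_add]
  congr 1
  push_cast
  ring

/-- `e^{−iπas}·e^{−5κ/4}·e^{(κ+iΛ₊)/4} = e^{−κ}·e^{iΛ₋/4}`. [folklore] -/
theorem expid_14_W3 :
    Complex.exp ((((-(Real.pi * a)) * s : ℝ)) * Complex.I) * Complex.exp (-(((2 * Real.pi * a) : ℝ) : ℂ) * (5 / 4 : ℝ)) * Complex.exp (((((((2 * Real.pi * a)) : ℝ)) : ℂ) + ((((2 * Real.pi * ξ) + (2 * Real.pi * a) * s : ℝ)) : ℂ) * Complex.I) * ((((1 / 4 : ℝ)) : ℝ) : ℂ)) =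
      (Real.exp (-(2 * Real.pi * a)) : ℂ) * Complex.exp (((((2 * Real.pi * ξ) + (-(2 * Real.pi * a)) * s) * (1 / 4) : ℝ) : ℂ) * Complex.I) := by
  rw [Complex.ofReal_exp, ← Complex.exp_add, ← Complex.exp_add, ← Complex.exp_add]
  congr 1
  push_cast
  ring

/-- `e^{−iπas}·e^{5κ/4}·e^{(−κ+iΛ₊)/4} = e^{κ}·e^{iΛ₋/4}`. [folklore] -/
theorem expid_14_W4 :
    Complex.exp ((((-(Real.pi * a)) * s : ℝ)) * Complex.I) * Complex.exp ((((2 * Real.pi * a) : ℝ) : ℂ) * (5 / 4 : ℝ)) * Complex.exp ((((((-(2 * Real.pi * a)) : ℝ)) : ℂ) + ((((2 * Real.pi * ξ) + (2 * Real.pi * a) * s : ℝ)) : ℂ) * Complex.I) * ((((1 / 4 : ℝ)) : ℝ) : ℂ)) =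
      (Real.exp (2 * Real.pi * a) : ℂ) * Complex.exp (((((2 * Real.pi * ξ) + (-(2 * Real.pi * a)) * s) * (1 / 4) : ℝ) : ℂ) * Complex.I) := by
  rw [Complex.ofReal_exp, ← Complex.exp_add, ← Complex.exp_add, ← Complex.exp_add]
  congr 1
  push_cast
  ring

end expid

/-- At `y = ±½` the crest and trough `A`-terms agree when `ξ − β ∈ ℤ` (Bloch periodicity). [folklore] -/
theorem expid_12_A (a β : ℝ) (n : ℤ) {ξ : ℝ} (hξ : ξ = β + n) (s : ℝ) :
    Complex.exp ((((-(Real.pi * a)) * s : ℝ)) * Complex.I) * (starRingEnd ℂ (Complex.exp (2 * Real.pi * β * Complex.I))) * Complex.exp (-(((2 * Real.pi * a) : ℝ) : ℂ) * (5 / 4 : ℝ)) *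
        Complex.exp (((((((2 * Real.pi * a)) : ℝ)) : ℂ) + ((((2 * Real.pi * ξ) + (2 * Real.pi * a) * s : ℝ)) : ℂ) * Complex.I) * ((((1 / 2 : ℝ)) : ℝ) : ℂ)) =
      Complex.exp ((((Real.pi * a) * s : ℝ)) * Complex.I) * Complex.exp (-(((2 * Real.pi * a) : ℝ) : ℂ) * (1 / 4 : ℝ)) * Complex.exp (((((((2 * Real.pi * a)) : ℝ)) : ℂ) + ((((2 * Real.pi * ξ) + (2 * Real.pi * a) * s : ℝ)) : ℂ) * Complex.I) * (((-(1 / 2 : ℝ)) : ℝ) : ℂ)) := by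
  rw [conj_blochZ, hξ]
  simp only [← Complex.exp_add]
  rw [Complex.exp_eq_exp_iff_exists_int]
  refine ⟨n, ?_⟩
  push_cast
  ring

/-- At `y = ±½` the crest and trough `B`-terms agree when `ξ − β ∈ ℤ`. [folklore] -/
theorem expid_12_B (a β : ℝ) (n : ℤ) {ξ : ℝ} (hξ : ξ = β + n) (s : ℝ) :
    Complex.exp ((((-(Real.pi * a)) * s : ℝ)) * Complex.I) * (starRingEnd ℂ (Complex.exp (2 * Real.pi * β * Complex.I))) * Complex.exp ((((2 * Real.pi * a) : ℝ) : ℂ) * (5 / 4 : ℝ)) *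
        Complex.exp ((((((-(2 * Real.pi * a)) : ℝ)) : ℂ) + ((((2 * Real.pi * ξ) + (2 * Real.pi * a) * s : ℝ)) : ℂ) * Complex.I) * ((((1 / 2 : ℝ)) : ℝ) : ℂ)) =
      Complex.exp ((((Real.pi * a) * s : ℝ)) * Complex.I) * Complex.exp ((((2 * Real.pi * a) : ℝ) : ℂ) * (1 / 4 : ℝ)) * Complex.exp ((((((-(2 * Real.pi * a)) : ℝ)) : ℂ) + ((((2 * Real.pi * ξ) + (2 * Real.pi * a) * s : ℝ)) : ℂ) * Complex.I) * (((-(1 / 2 : ℝ)) : ℝ) : ℂ)) := by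
  rw [conj_blochZ, hξ]
  simp only [← Complex.exp_add]
  rw [Complex.exp_eq_exp_iff_exists_int]
  refine ⟨n, ?_⟩
  push_cast
  ring


/-! ## §4 The paired bound at the kernel's line `y₀ = ¼` -/

section paired

variable {a : ℝ} {K G : ℝ → ℂ}

/-- **Source at `y₀ = ¼`, lattice mode `ξ = β + n`, PAIRED pointwise bound** (`a > 0`, any `β`, `s`):
`‖∫_{−½}^{½} G(¼−y) e^{2πiξy} e^{−2πiasT(y)} dy‖ ≤ (1/(1+(u−s)²) + q/(1+(u+s)²) + (1+q+2x²)|s|/(√(1+(u+s)²)√(1+(u−s)²)))/((1−q)κ²)`,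
`u = ξ/a`, `κ = 2πa`, `q = e^{−κ}`, `x = e^{−κ/4}`: the one-sided boundary terms of the closed form are paired at `y = ¼` (continuity of the
integrand across the kernel's own line and the kink of `T`), agree termwise at `y = −¼` and cancel at `y = ±½`; every surviving quantity is
`O(1/Λ²)`, `Λ = κ(u∓s)`. [cite: Drazin2002, §8.3 (8.36)–(8.38)] -/
theorem norm_src_quarter_lattice_le (ha : 0 < a) (β : ℝ) (n : ℤ) {ξ : ℝ} (hξ : ξ = β + n) (s : ℝ)
    (hK : K = fun r : ℝ => (-((Real.exp (-(2 * Real.pi * a * r)) : ℂ) /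
            (1 - starRingEnd ℂ (Complex.exp (2 * Real.pi * β * Complex.I)) * (Real.exp (-(2 * Real.pi * a)) : ℂ))
          + (Real.exp (2 * Real.pi * a * (r - 1)) : ℂ) * Complex.exp (2 * Real.pi * β * Complex.I) /
            (1 - Complex.exp (2 * Real.pi * β * Complex.I) * (Real.exp (-(2 * Real.pi * a)) : ℂ))) /
        (2 * (2 * Real.pi * a) : ℂ)))
    (hG : ∀ u : ℝ, G u = Complex.exp (2 * Real.pi * β * (⌊u⌋ : ℝ) * Complex.I) * K (u - ⌊u⌋)) :
    ‖∫ y in (-(1 / 2 : ℝ))..(1 / 2 : ℝ), G ((1 / 4 : ℝ) - y) * Complex.exp (((2 * Real.pi * ξ * y : ℝ) : ℂ) * Complex.I) *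
        Complex.exp (-((2 * Real.pi * a * s * triWave y : ℝ) : ℂ) * Complex.I)‖ ≤
      (1 / (1 + (ξ / a + (-1) * s) ^ 2) + Real.exp (-(2 * Real.pi * a)) / (1 + (ξ / a + 1 * s) ^ 2) +
          (1 + Real.exp (-(2 * Real.pi * a)) + 2 * Real.exp (-(2 * Real.pi * a) / 4) ^ 2) * |s| /
            (Real.sqrt (1 + (ξ / a + 1 * s) ^ 2) * Real.sqrt (1 + (ξ / a + (-1) * s) ^ 2))) /
        ((1 - Real.exp (-(2 * Real.pi * a))) * (2 * Real.pi * a) ^ 2) := by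
  rw [src_quarter_pieces ha β ξ hK hG s]
  have hκ0 : 0 < 2 * Real.pi * a := by positivity
  have hκne : (2 * Real.pi * a : ℝ) ≠ 0 := hκ0.ne'
  have hκne' : (-(2 * Real.pi * a) : ℝ) ≠ 0 := by linarith
  -- norms and non-vanishing of the four Lorentz denominators
  have nL1 := norm_lorentz_denom_mode ha (μ := 2 * Real.pi * a) (Or.inl rfl) (σ := 1) (ν := 2 * Real.pi * a) (by ring)
    (ν₀ := 2 * Real.pi * ξ) rfl s
  have nL2 := norm_lorentz_denom_mode ha (μ := -(2 * Real.pi * a)) (Or.inr rfl) (σ := 1) (ν := 2 * Real.pi * a) (by ring)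
    (ν₀ := 2 * Real.pi * ξ) rfl s
  have nL3 := norm_lorentz_denom_mode ha (μ := 2 * Real.pi * a) (Or.inl rfl) (σ := -1) (ν := -(2 * Real.pi * a)) (by ring)
    (ν₀ := 2 * Real.pi * ξ) rfl s
  have nL4 := norm_lorentz_denom_mode ha (μ := -(2 * Real.pi * a)) (Or.inr rfl) (σ := -1) (ν := -(2 * Real.pi * a)) (by ring)
    (ν₀ := 2 * Real.pi * ξ) rfl s
  have zL1 := lorentz_denom_ne_zero hκne ((2 * Real.pi * ξ) + (2 * Real.pi * a) * s)
  have zL2 := lorentz_denom_ne_zero hκne' ((2 * Real.pi * ξ) + (2 * Real.pi * a) * s)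
  have zL3 := lorentz_denom_ne_zero hκne ((2 * Real.pi * ξ) + (-(2 * Real.pi * a)) * s)
  have zL4 := lorentz_denom_ne_zero hκne' ((2 * Real.pi * ξ) + (-(2 * Real.pi * a)) * s)
  -- differences of denominators
  have d43 : ‖(((((-(2 * Real.pi * a)) : ℝ)) : ℂ) + ((((2 * Real.pi * ξ) + (-(2 * Real.pi * a)) * s : ℝ)) : ℂ) * Complex.I) - (((((2 * Real.pi * a) : ℝ)) : ℂ) + ((((2 * Real.pi * ξ) + (-(2 * Real.pi * a)) * s : ℝ)) : ℂ) * Complex.I)‖ = 2 * (2 * Real.pi * a) := by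
    rw [show (((((-(2 * Real.pi * a)) : ℝ)) : ℂ) + ((((2 * Real.pi * ξ) + (-(2 * Real.pi * a)) * s : ℝ)) : ℂ) * Complex.I) - (((((2 * Real.pi * a) : ℝ)) : ℂ) + ((((2 * Real.pi * ξ) + (-(2 * Real.pi * a)) * s : ℝ)) : ℂ) * Complex.I) = (((-(2 * (2 * Real.pi * a))) : ℝ) : ℂ) by push_cast; ring,
      Complex.norm_real, Real.norm_eq_abs, abs_of_neg (by linarith)]; ring
  have d21 : ‖(((((-(2 * Real.pi * a)) : ℝ)) : ℂ) + ((((2 * Real.pi * ξ) + (2 * Real.pi * a) * s : ℝ)) : ℂ) * Complex.I) - (((((2 * Real.pi * a) : ℝ)) : ℂ) + ((((2 * Real.pi * ξ) + (2 * Real.pi * a) * s : ℝ)) : ℂ) * Complex.I)‖ = 2 * (2 * Real.pi * a) := by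
    rw [show (((((-(2 * Real.pi * a)) : ℝ)) : ℂ) + ((((2 * Real.pi * ξ) + (2 * Real.pi * a) * s : ℝ)) : ℂ) * Complex.I) - (((((2 * Real.pi * a) : ℝ)) : ℂ) + ((((2 * Real.pi * ξ) + (2 * Real.pi * a) * s : ℝ)) : ℂ) * Complex.I) = (((-(2 * (2 * Real.pi * a))) : ℝ) : ℂ) by push_cast; ring,
      Complex.norm_real, Real.norm_eq_abs, abs_of_neg (by linarith)]; ring
  have d24 : ‖(((((-(2 * Real.pi * a)) : ℝ)) : ℂ) + ((((2 * Real.pi * ξ) + (2 * Real.pi * a) * s : ℝ)) : ℂ) * Complex.I) - (((((-(2 * Real.pi * a)) : ℝ)) : ℂ) + ((((2 * Real.pi * ξ) + (-(2 * Real.pi * a)) * s : ℝ)) : ℂ) * Complex.I)‖ = 2 * (2 * Real.pi * a) * |s| := by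
    rw [show (((((-(2 * Real.pi * a)) : ℝ)) : ℂ) + ((((2 * Real.pi * ξ) + (2 * Real.pi * a) * s : ℝ)) : ℂ) * Complex.I) - (((((-(2 * Real.pi * a)) : ℝ)) : ℂ) + ((((2 * Real.pi * ξ) + (-(2 * Real.pi * a)) * s : ℝ)) : ℂ) * Complex.I) = (((2 * (2 * Real.pi * a)) * s : ℝ) : ℂ) * Complex.I by push_cast; ring,
      norm_mul, Complex.norm_I, mul_one, Complex.norm_real, Real.norm_eq_abs, abs_mul, abs_of_pos (by positivity)]
  have d31 : ‖(((((2 * Real.pi * a) : ℝ)) : ℂ) + ((((2 * Real.pi * ξ) + (-(2 * Real.pi * a)) * s : ℝ)) : ℂ) * Complex.I) - (((((2 * Real.pi * a) : ℝ)) : ℂ) + ((((2 * Real.pi * ξ) + (2 * Real.pi * a) * s : ℝ)) : ℂ) * Complex.I)‖ = 2 * (2 * Real.pi * a) * |s| := by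
    rw [show (((((2 * Real.pi * a) : ℝ)) : ℂ) + ((((2 * Real.pi * ξ) + (-(2 * Real.pi * a)) * s : ℝ)) : ℂ) * Complex.I) - (((((2 * Real.pi * a) : ℝ)) : ℂ) + ((((2 * Real.pi * ξ) + (2 * Real.pi * a) * s : ℝ)) : ℂ) * Complex.I) = (((-(2 * (2 * Real.pi * a)) * s) : ℝ) : ℂ) * Complex.I by push_cast; ring,
      norm_mul, Complex.norm_I, mul_one, Complex.norm_real, Real.norm_eq_abs, abs_mul, abs_of_neg (by linarith)]; ring
  have d42 : ‖(((((-(2 * Real.pi * a)) : ℝ)) : ℂ) + ((((2 * Real.pi * ξ) + (-(2 * Real.pi * a)) * s : ℝ)) : ℂ) * Complex.I) - (((((-(2 * Real.pi * a)) : ℝ)) : ℂ) + ((((2 * Real.pi * ξ) + (2 * Real.pi * a) * s : ℝ)) : ℂ) * Complex.I)‖ = 2 * (2 * Real.pi * a) * |s| := by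
    rw [show (((((-(2 * Real.pi * a)) : ℝ)) : ℂ) + ((((2 * Real.pi * ξ) + (-(2 * Real.pi * a)) * s : ℝ)) : ℂ) * Complex.I) - (((((-(2 * Real.pi * a)) : ℝ)) : ℂ) + ((((2 * Real.pi * ξ) + (2 * Real.pi * a) * s : ℝ)) : ℂ) * Complex.I) = (((-(2 * (2 * Real.pi * a)) * s) : ℝ) : ℂ) * Complex.I by push_cast; ring,
      norm_mul, Complex.norm_I, mul_one, Complex.norm_real, Real.norm_eq_abs, abs_mul, abs_of_neg (by linarith)]; ring
  -- norms of the exponentials that matter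
  have ne3p4 : ‖Complex.exp ((((((2 * Real.pi * a) : ℝ)) : ℂ) + ((((2 * Real.pi * ξ) + (-(2 * Real.pi * a)) * s : ℝ)) : ℂ) * Complex.I) * ((((1 / 4 : ℝ)) : ℝ) : ℂ))‖ = Real.exp ((2 * Real.pi * a) * (1 / 4)) := norm_cexp_lorentz_mul _ _ _
  have ne4p4 : ‖Complex.exp ((((((-(2 * Real.pi * a)) : ℝ)) : ℂ) + ((((2 * Real.pi * ξ) + (-(2 * Real.pi * a)) * s : ℝ)) : ℂ) * Complex.I) * ((((1 / 4 : ℝ)) : ℝ) : ℂ))‖ = Real.exp ((-(2 * Real.pi * a)) * (1 / 4)) := norm_cexp_lorentz_mul _ _ _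
  have ne1p4 : ‖Complex.exp ((((((2 * Real.pi * a) : ℝ)) : ℂ) + ((((2 * Real.pi * ξ) + (2 * Real.pi * a) * s : ℝ)) : ℂ) * Complex.I) * ((((1 / 4 : ℝ)) : ℝ) : ℂ))‖ = Real.exp ((2 * Real.pi * a) * (1 / 4)) := norm_cexp_lorentz_mul _ _ _
  have ne1m4 : ‖Complex.exp ((((((2 * Real.pi * a) : ℝ)) : ℂ) + ((((2 * Real.pi * ξ) + (2 * Real.pi * a) * s : ℝ)) : ℂ) * Complex.I) * (((-(1 / 4 : ℝ)) : ℝ) : ℂ))‖ = Real.exp ((2 * Real.pi * a) * (-(1 / 4))) := norm_cexp_lorentz_mul _ _ _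
  have ne2m4 : ‖Complex.exp ((((((-(2 * Real.pi * a)) : ℝ)) : ℂ) + ((((2 * Real.pi * ξ) + (2 * Real.pi * a) * s : ℝ)) : ℂ) * Complex.I) * (((-(1 / 4 : ℝ)) : ℝ) : ℂ))‖ = Real.exp ((-(2 * Real.pi * a)) * (-(1 / 4))) := norm_cexp_lorentz_mul _ _ _
  have nP1 : ‖Complex.exp ((((Real.pi * a) * s : ℝ)) * Complex.I)‖ = 1 := Complex.norm_exp_ofReal_mul_I _
  have nP2 : ‖Complex.exp ((((0 : ℝ) * s : ℝ)) * Complex.I)‖ = 1 := Complex.norm_exp_ofReal_mul_I _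
  have nP3 : ‖Complex.exp ((((-(Real.pi * a)) * s : ℝ)) * Complex.I)‖ = 1 := Complex.norm_exp_ofReal_mul_I _
  have hP2 : Complex.exp ((((0 : ℝ) * s : ℝ)) * Complex.I) = 1 := by simp
  have nzc : ‖(starRingEnd ℂ (Complex.exp (2 * Real.pi * β * Complex.I)))‖ = 1 := norm_pref_conj β
  have nEm1 : ‖Complex.exp (-(((2 * Real.pi * a) : ℝ) : ℂ) * (1 / 4 : ℝ))‖ = Real.exp (-(2 * Real.pi * a) * (1 / 4)) := by
    rw [show -(((2 * Real.pi * a) : ℝ) : ℂ) * (1 / 4 : ℝ) = (((-(2 * Real.pi * a) * (1 / 4)) : ℝ) : ℂ) by push_cast; ring, Complex.norm_exp_ofReal]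
  have nEp1 : ‖Complex.exp ((((2 * Real.pi * a) : ℝ) : ℂ) * (1 / 4 : ℝ))‖ = Real.exp ((2 * Real.pi * a) * (1 / 4)) := by
    rw [show (((2 * Real.pi * a) : ℝ) : ℂ) * (1 / 4 : ℝ) = ((((2 * Real.pi * a) * (1 / 4)) : ℝ) : ℂ) by push_cast; ring, Complex.norm_exp_ofReal]
  have nEm5 : ‖Complex.exp (-(((2 * Real.pi * a) : ℝ) : ℂ) * (5 / 4 : ℝ))‖ = Real.exp (-(2 * Real.pi * a) * (5 / 4)) := by
    rw [show -(((2 * Real.pi * a) : ℝ) : ℂ) * (5 / 4 : ℝ) = (((-(2 * Real.pi * a) * (5 / 4)) : ℝ) : ℂ) by push_cast; ring, Complex.norm_exp_ofReal]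
  have nA := norm_coefA_le ha β
  have nB := norm_coefB_le ha β
  -- exponential identities
  have I1 := expid_m14_A a ξ s
  have I2 := expid_m14_B a ξ s
  have I3 := expid_12_A a β n hξ s
  have I4 := expid_12_B a β n hξ s
  have W1 := expid_14_W1 a ξ s
  have W2 := expid_14_W2 a ξ s
  have W3 := expid_14_W3 a ξ s
  have W4 := expid_14_W4 a ξ s
  have KC := kernel_coef_continuity ha β
  -- abbreviations
  set A : ℂ := (-1 / ((1 - starRingEnd ℂ (Complex.exp (2 * Real.pi * β * Complex.I)) * (Real.exp (-(2 * Real.pi * a)) : ℂ)) * (2 * (2 * Real.pi * a))) : ℂ) with hA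
  set B : ℂ := (-(Complex.exp (2 * Real.pi * β * Complex.I) * (Real.exp (-(2 * Real.pi * a)) : ℂ)) / ((1 - Complex.exp (2 * Real.pi * β * Complex.I) * (Real.exp (-(2 * Real.pi * a)) : ℂ)) * (2 * (2 * Real.pi * a))) : ℂ) with hB
  set zc : ℂ := (starRingEnd ℂ (Complex.exp (2 * Real.pi * β * Complex.I))) with hzc
  set Em1 : ℂ := Complex.exp (-(((2 * Real.pi * a) : ℝ) : ℂ) * (1 / 4 : ℝ)) with hEm1
  set Ep1 : ℂ := Complex.exp ((((2 * Real.pi * a) : ℝ) : ℂ) * (1 / 4 : ℝ)) with hEp1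
  set Em5 : ℂ := Complex.exp (-(((2 * Real.pi * a) : ℝ) : ℂ) * (5 / 4 : ℝ)) with hEm5
  set Ep5 : ℂ := Complex.exp ((((2 * Real.pi * a) : ℝ) : ℂ) * (5 / 4 : ℝ)) with hEp5
  set P₁ : ℂ := Complex.exp ((((Real.pi * a) * s : ℝ)) * Complex.I) with hP₁
  set P₂ : ℂ := Complex.exp ((((0 : ℝ) * s : ℝ)) * Complex.I) with hP₂
  set P₃ : ℂ := Complex.exp ((((-(Real.pi * a)) * s : ℝ)) * Complex.I) with hP₃
  set Wq : ℂ := Complex.exp (((((2 * Real.pi * ξ) + (-(2 * Real.pi * a)) * s) * (1 / 4) : ℝ) : ℂ) * Complex.I) with hWq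
  set L₁ : ℂ := (((((2 * Real.pi * a) : ℝ)) : ℂ) + ((((2 * Real.pi * ξ) + (2 * Real.pi * a) * s : ℝ)) : ℂ) * Complex.I) with hL₁
  set L₂ : ℂ := (((((-(2 * Real.pi * a)) : ℝ)) : ℂ) + ((((2 * Real.pi * ξ) + (2 * Real.pi * a) * s : ℝ)) : ℂ) * Complex.I) with hL₂
  set L₃ : ℂ := (((((2 * Real.pi * a) : ℝ)) : ℂ) + ((((2 * Real.pi * ξ) + (-(2 * Real.pi * a)) * s : ℝ)) : ℂ) * Complex.I) with hL₃
  set L₄ : ℂ := (((((-(2 * Real.pi * a)) : ℝ)) : ℂ) + ((((2 * Real.pi * ξ) + (-(2 * Real.pi * a)) * s : ℝ)) : ℂ) * Complex.I) with hL₄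
  set e1m4 : ℂ := Complex.exp (L₁ * (((-(1 / 4 : ℝ)) : ℝ) : ℂ)) with he1m4
  set e1m2 : ℂ := Complex.exp (L₁ * (((-(1 / 2 : ℝ)) : ℝ) : ℂ)) with he1m2
  set e2m4 : ℂ := Complex.exp (L₂ * (((-(1 / 4 : ℝ)) : ℝ) : ℂ)) with he2m4
  set e2m2 : ℂ := Complex.exp (L₂ * (((-(1 / 2 : ℝ)) : ℝ) : ℂ)) with he2m2
  set e3p4 : ℂ := Complex.exp (L₃ * ((((1 / 4 : ℝ)) : ℝ) : ℂ)) with he3p4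
  set e3m4 : ℂ := Complex.exp (L₃ * (((-(1 / 4 : ℝ)) : ℝ) : ℂ)) with he3m4
  set e4p4 : ℂ := Complex.exp (L₄ * ((((1 / 4 : ℝ)) : ℝ) : ℂ)) with he4p4
  set e4m4 : ℂ := Complex.exp (L₄ * (((-(1 / 4 : ℝ)) : ℝ) : ℂ)) with he4m4
  set e1p2 : ℂ := Complex.exp (L₁ * ((((1 / 2 : ℝ)) : ℝ) : ℂ)) with he1p2
  set e1p4 : ℂ := Complex.exp (L₁ * ((((1 / 4 : ℝ)) : ℝ) : ℂ)) with he1p4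
  set e2p2 : ℂ := Complex.exp (L₂ * ((((1 / 2 : ℝ)) : ℝ) : ℂ)) with he2p2
  set e2p4 : ℂ := Complex.exp (L₂ * ((((1 / 4 : ℝ)) : ℝ) : ℂ)) with he2p4
  rw [six_pieces_regroup]
  -- the boundary identities in abbreviated form
  have hV : P₂ * (1 * A * Em1) * e3p4 + P₂ * (1 * B * Ep1) * e4p4 = P₃ * (zc * A * Em5) * e1p4 + P₃ * (zc * B * Ep5) * e2p4 := by
    linear_combination (A * Em1 * e3p4 + B * Ep1 * e4p4) * hP2 + A * W1 + B * W2 - zc * A * W3 - zc * B * W4 + Wq * KC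
  have hτ₁ : P₂ * (1 * A * Em1) * e3m4 = P₁ * (1 * A * Em1) * e1m4 := by linear_combination (-(1 * A * Em1)) * I1
  have hτ₂ : P₂ * (1 * B * Ep1) * e4m4 = P₁ * (1 * B * Ep1) * e2m4 := by linear_combination (-(1 * B * Ep1)) * I2
  have hσ₁ : P₃ * (zc * A * Em5) * e1p2 = P₁ * (1 * A * Em1) * e1m2 := by linear_combination A * I3
  have hσ₂ : P₃ * (zc * B * Ep5) * e2p2 = P₁ * (1 * B * Ep1) * e2m2 := by linear_combination B * I4
  rw [hτ₁, hτ₂, hσ₁, hσ₂, sub_self, sub_self, add_zero, add_zero]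
  -- powers of `x = e^{-κ/4}`
  set X : ℝ := Real.exp (-(2 * Real.pi * a) / 4) with hX
  have hX0 : 0 < X := Real.exp_pos _
  have hq : Real.exp (-(2 * Real.pi * a)) = X ^ 4 := by rw [hX, ← Real.exp_nat_mul]; congr 1; push_cast; ring
  have hx1 : Real.exp (-(2 * Real.pi * a) * (1 / 4)) = X := by rw [hX]; congr 1; ring
  have hx1' : Real.exp (2 * Real.pi * a * -(1 / 4)) = X := by rw [hX]; congr 1; ring
  have hxi : Real.exp (2 * Real.pi * a * (1 / 4)) = X⁻¹ := by rw [hX, ← Real.exp_neg]; congr 1; ring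
  have hxi' : Real.exp (-(2 * Real.pi * a) * -(1 / 4)) = X⁻¹ := by rw [hX, ← Real.exp_neg]; congr 1; ring
  have hx5 : Real.exp (-(2 * Real.pi * a) * (5 / 4)) = X ^ 5 := by rw [hX, ← Real.exp_nat_mul]; congr 1; push_cast; ring
  have hX1 : X ^ 4 < 1 := by rw [← hq]; exact Real.exp_lt_one_iff.2 (by linarith)
  -- norms of the boundary values
  have nLp : ‖P₂ * (1 * A * Em1) * e3p4‖ = ‖A‖ := by
    rw [norm_mul, norm_mul, norm_mul, norm_mul, norm_one, nP2, nEm1, ne3p4, hx1, hxi]; field_simp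
  have nLm : ‖P₂ * (1 * B * Ep1) * e4p4‖ = ‖B‖ := by
    rw [norm_mul, norm_mul, norm_mul, norm_mul, norm_one, nP2, nEp1, ne4p4, hx1, hxi]; field_simp
  have nRp : ‖P₃ * (zc * A * Em5) * e1p4‖ = ‖A‖ * X ^ 4 := by
    rw [norm_mul, norm_mul, norm_mul, norm_mul, nP3, nzc, nEm5, ne1p4, hx5, hxi]; field_simp
  have nτ₁ : ‖P₁ * (1 * A * Em1) * e1m4‖ = ‖A‖ * X ^ 2 := by
    rw [norm_mul, norm_mul, norm_mul, norm_mul, norm_one, nP1, nEm1, ne1m4, hx1, hx1']; ring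
  have nτ₂ : ‖P₁ * (1 * B * Ep1) * e2m4‖ = ‖B‖ * (X⁻¹) ^ 2 := by
    rw [norm_mul, norm_mul, norm_mul, norm_mul, norm_one, nP1, nEp1, ne2m4, hxi, hxi']; ring
  have nV : ‖P₂ * (1 * A * Em1) * e3p4 + P₂ * (1 * B * Ep1) * e4p4‖ ≤ ‖A‖ + ‖B‖ := by
    refine (norm_add_le _ _).trans (le_of_eq ?_); rw [nLp, nLm]
  -- the two surviving groups
  set Dp : ℝ := Real.sqrt (1 + (ξ / a + 1 * s) ^ 2) with hDp
  set Dm : ℝ := Real.sqrt (1 + (ξ / a + (-1) * s) ^ 2) with hDm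
  have hDp0 : 0 < Dp := Real.sqrt_pos.2 (by positivity)
  have hDm0 : 0 < Dm := Real.sqrt_pos.2 (by positivity)
  have hDp2 : Dp ^ 2 = 1 + (ξ / a + 1 * s) ^ 2 := Real.sq_sqrt (by positivity)
  have hDm2 : Dm ^ 2 = 1 + (ξ / a + (-1) * s) ^ 2 := Real.sq_sqrt (by positivity)
  have hA0 : 0 ≤ ‖A‖ := norm_nonneg _
  have hB0 : 0 ≤ ‖B‖ := norm_nonneg _
  have hG14 := norm_kink_pair_le hV zL1 zL2 zL3 zL4
  rw [nLp, nRp, d43, d21, d24, nL1, nL2, nL3, nL4] at hG14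
  have hG14' : ‖P₂ * (1 * A * Em1) * e3p4 / L₃ + P₂ * (1 * B * Ep1) * e4p4 / L₄ - P₃ * (zc * A * Em5) * e1p4 / L₁ -
      P₃ * (zc * B * Ep5) * e2p4 / L₂‖ ≤
      ‖A‖ * (2 * (2 * Real.pi * a)) / ((2 * Real.pi * a * Dm) * (2 * Real.pi * a * Dm)) +
        ‖A‖ * X ^ 4 * (2 * (2 * Real.pi * a)) / ((2 * Real.pi * a * Dp) * (2 * Real.pi * a * Dp)) +
        (‖A‖ + ‖B‖) * (2 * (2 * Real.pi * a) * |s|) / ((2 * Real.pi * a * Dp) * (2 * Real.pi * a * Dm)) := by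
    refine hG14.trans (add_le_add le_rfl ?_)
    exact div_le_div_of_nonneg_right (mul_le_mul_of_nonneg_right nV (by positivity)) (by positivity)
  have hGm14 : ‖P₁ * (1 * A * Em1) * e1m4 / L₁ - P₁ * (1 * A * Em1) * e1m4 / L₃ +
      (P₁ * (1 * B * Ep1) * e2m4 / L₂ - P₁ * (1 * B * Ep1) * e2m4 / L₄)‖ ≤
      ‖A‖ * X ^ 2 * (2 * (2 * Real.pi * a) * |s|) / ((2 * Real.pi * a * Dp) * (2 * Real.pi * a * Dm)) +
        ‖B‖ * (X⁻¹) ^ 2 * (2 * (2 * Real.pi * a) * |s|) / ((2 * Real.pi * a * Dp) * (2 * Real.pi * a * Dm)) := by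
    refine (norm_add_le _ _).trans (le_of_eq ?_)
    rw [norm_same_pair_eq _ zL1 zL3, norm_same_pair_eq _ zL2 zL4, nτ₁, nτ₂, d31, d42, nL1, nL2, nL3, nL4]
  refine (norm_add_le _ _).trans ((add_le_add hG14' hGm14).trans ?_)
  -- substitute the coefficient bounds and simplify
  rw [hq] at nA nB ⊢
  have h1q : 0 < 1 - X ^ 4 := by linarith
  have key : ‖A‖ * (2 * (2 * Real.pi * a)) / ((2 * Real.pi * a * Dm) * (2 * Real.pi * a * Dm)) +
        ‖A‖ * X ^ 4 * (2 * (2 * Real.pi * a)) / ((2 * Real.pi * a * Dp) * (2 * Real.pi * a * Dp)) +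
        (‖A‖ + ‖B‖) * (2 * (2 * Real.pi * a) * |s|) / ((2 * Real.pi * a * Dp) * (2 * Real.pi * a * Dm)) +
      (‖A‖ * X ^ 2 * (2 * (2 * Real.pi * a) * |s|) / ((2 * Real.pi * a * Dp) * (2 * Real.pi * a * Dm)) +
        ‖B‖ * (X⁻¹) ^ 2 * (2 * (2 * Real.pi * a) * |s|) / ((2 * Real.pi * a * Dp) * (2 * Real.pi * a * Dm))) =
      ‖A‖ * ((2 * (2 * Real.pi * a)) / ((2 * Real.pi * a * Dm) * (2 * Real.pi * a * Dm)) +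
          X ^ 4 * (2 * (2 * Real.pi * a)) / ((2 * Real.pi * a * Dp) * (2 * Real.pi * a * Dp)) +
          (1 + X ^ 2) * (2 * (2 * Real.pi * a) * |s|) / ((2 * Real.pi * a * Dp) * (2 * Real.pi * a * Dm))) +
        ‖B‖ * ((1 + (X⁻¹) ^ 2) * (2 * (2 * Real.pi * a) * |s|) / ((2 * Real.pi * a * Dp) * (2 * Real.pi * a * Dm))) := by ring
  rw [key]
  have cA : 0 ≤ (2 * (2 * Real.pi * a)) / ((2 * Real.pi * a * Dm) * (2 * Real.pi * a * Dm)) +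
      X ^ 4 * (2 * (2 * Real.pi * a)) / ((2 * Real.pi * a * Dp) * (2 * Real.pi * a * Dp)) +
      (1 + X ^ 2) * (2 * (2 * Real.pi * a) * |s|) / ((2 * Real.pi * a * Dp) * (2 * Real.pi * a * Dm)) := by positivity
  have cB : 0 ≤ (1 + (X⁻¹) ^ 2) * (2 * (2 * Real.pi * a) * |s|) / ((2 * Real.pi * a * Dp) * (2 * Real.pi * a * Dm)) := by positivity
  refine (add_le_add (mul_le_mul_of_nonneg_right nA cA) (mul_le_mul_of_nonneg_right nB cB)).trans (le_of_eq ?_)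
  rw [show (1 : ℝ) / (1 + (ξ / a + (-1) * s) ^ 2) = 1 / Dm ^ 2 by rw [hDm2],
    show X ^ 4 / (1 + (ξ / a + 1 * s) ^ 2) = X ^ 4 / Dp ^ 2 by rw [hDp2]]
  field_simp
  ring

end paired


end Summit.AnomalousDissipation.AnomalousDissipation.Theorems.SawtoothPulseCascade.K2PhaseBudget

end
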